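import Summits.BirchSwinnertonDyer.BirchSwinnertonDyer.Theorems.EisensteinDepletionAtTwoStarOptBNSFKummerForm
import Summits.BirchSwinnertonDyer.BirchSwinnertonDyer.Theorems.EisensteinDepletionAtTwoStarOptBNSFParityGroup
import Summits.BirchSwinnertonDyer.BirchSwinnertonDyer.Theorems.EisensteinDepletionAtTwoStarDefs
import Summits.BirchSwinnertonDyer.BirchSwinnertonDyer.Theorems.EisensteinDepletionAtTwoStarGO2UBDGroupLemma
import Literature.NumberTheory.EllipticCurves.HalfIntegralWeightForms
import HarnessLib

/-!
# Line `kummer` v7, stub K-A `stub_kummerSqrtFormSigma` — Core: the TWISTED Kummer form `u · h_κ` as a cusp form on `Γ″`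
(crux `StarGO2Sigma`, stmt-BirchSwinnertonDyer-27046; lead bsd-rank2-star-p1 GEN 13)

The analytic half of stub K-A of the registered kummer skeleton v7.  Given
* the square root `u` of the Eisenstein `η`-quotient (stub K-U's output, here a hypothesis): holomorphic, nowhere zero,
  `u² = V ∈ M_{24m}(Γ₀(N))`, weight-`12m` multiplier `(−1)^{φ_β(γ)/g'}` on `Γ₀(N)`;
* a cusp form `hκ ∈ S_k(Γ′)` on the UNTWISTED Kummer parity group `Γ′ ⊆ Γ₁(N)` which is `±`-equivariant under `Γ₁(N)`
  (sign `+` exactly on `Γ′`) and whose square is `Ψ·G` for cusp forms `Ψ, G` on `Γ₁(N)` (nsf's `KummerForm.stub_kummerForm`);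
* cusp-evenness of the Eisenstein parity (the translation `T` has an even period);
we package `h := u·hκ` as a cusp form of weight `12m + k` on the TWISTED group
`Γ″ = {γ ∈ Γ₁(N) : φ_β(γ)/g' even ⟺ γ ∈ Γ′}`, anti-invariant under `Γ₁(N) ∖ Γ″`, non-zero, with
`qExpansion 1 h = qExpansion 1 u · qExpansion 1 hκ` (`twistedCuspForm`).  Pure complex analysis / bookkeeping over Mathlib's
slash actions and `qExpansion_mul`; no number theory.  Nothing here reads `r_an`; `StarGO2Sigma` / E1M / BSD are NOT proved
by this file.
-/

set_option linter.dupNamespace false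
set_option autoImplicit false

noncomputable section

open Complex Filter Topology Set Function Asymptotics
open UpperHalfPlane hiding I
open scoped Real Topology Manifold MatrixGroups ModularForm
open ModularForm CongruenceSubgroup
open Literature.NumberTheory.EllipticCurves Literature.NumberTheory.EllipticCurves.ModularForms
open Summit.BirchSwinnertonDyer.BirchSwinnertonDyer.Theorems.DepletionAtTwo

namespace Summit.BirchSwinnertonDyer.BirchSwinnertonDyer.Theorems.DepletionAtTwo.KummerSigma

/-! ### §1 Small analytic lemmas -/

/-- Bounded times zero at `i∞` is zero at `i∞`. [folklore] -/
theorem isZeroAtImInfty_mul_of_bdd {a b : ℍ → ℂ} (ha : IsBoundedAtImInfty a) (hb : IsZeroAtImInfty b) :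
    IsZeroAtImInfty (a * b) := by
  have ha' : a =O[atImInfty] (1 : ℍ → ℝ) := ha
  have hb' : b =O[atImInfty] (fun τ ↦ ‖b τ‖) := isBigO_norm_right.mpr (isBigO_refl b atImInfty)
  have h1 : (a * b) =O[atImInfty] (fun τ ↦ (1 : ℍ → ℝ) τ * ‖b τ‖) := ha'.mul hb'
  have h2 : Tendsto (fun τ ↦ (1 : ℍ → ℝ) τ * ‖b τ‖) atImInfty (𝓝 0) := by
    simpa using hb.norm
  exact h1.trans_tendsto h2

/-- A weight-`k` function invariant under the translation `T` is `1`-periodic (as a function on `ℂ` via `ofComplex`).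
[folklore] -/
theorem periodic_of_slash_T {u : ℍ → ℂ} {k : ℤ} (hT : u ∣[k] ModularGroup.T = u) :
    Periodic (u ∘ ofComplex) 1 := by
  intro z
  by_cases hz : 0 < z.im
  · have hz' : 0 < (z + 1).im := by simpa using hz
    have h := congr_fun hT (ofComplex z)
    rw [SL_slash_apply, ModularGroup.denom_apply] at h
    simp only [Function.comp_apply]
    have hT' : ModularGroup.T • ofComplex z = ofComplex (z + 1) := by
      apply UpperHalfPlane.ext
      rw [modular_T_smul, coe_vadd, ofComplex_apply_of_im_pos hz, ofComplex_apply_of_im_pos hz']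
      simp [add_comm]
    have hden : ((ModularGroup.T 1 0 : ℤ) : ℂ) * (ofComplex z : ℂ) + ((ModularGroup.T 1 1 : ℤ) : ℂ) = 1 := by
      simp [ModularGroup.T]
    rw [hden, one_zpow, mul_one, hT'] at h
    exact h
  · have h1 : z.im ≤ 0 := not_lt.mp hz
    have h2 : (z + 1).im ≤ 0 := by simpa using h1
    simp only [Function.comp_apply, ofComplex_apply_of_im_nonpos h1, ofComplex_apply_of_im_nonpos h2]

/-- If `‖u‖² = ‖V‖` pointwise and `V` is bounded at `i∞`, so is `u`. [folklore] -/
theorem isBoundedAtImInfty_of_norm_sq {u V : ℍ → ℂ} (h : ∀ τ, ‖u τ‖ ^ 2 = ‖V τ‖) (hV : IsBoundedAtImInfty V) :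
    IsBoundedAtImInfty u := by
  rw [UpperHalfPlane.isBoundedAtImInfty_iff] at hV ⊢
  obtain ⟨C, A, hC⟩ := hV
  refine ⟨Real.sqrt C, A, fun τ hτ ↦ ?_⟩
  rw [← Real.sqrt_sq (norm_nonneg (u τ)), h τ]
  exact Real.sqrt_le_sqrt (hC τ hτ)

/-- If `‖u‖² = ‖V‖` pointwise and `V` is zero at `i∞`, so is `u`. [folklore] -/
theorem isZeroAtImInfty_of_norm_sq' {u V : ℍ → ℂ} (h : ∀ τ, ‖u τ‖ ^ 2 = ‖V τ‖) (hV : IsZeroAtImInfty V) :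
    IsZeroAtImInfty u := by
  have h1 : ∀ τ : ℍ, ‖u τ‖ = Real.sqrt ‖V τ‖ := fun τ ↦ by
    rw [← h τ, Real.sqrt_sq (norm_nonneg _)]
  have h2 : Tendsto (fun τ : ℍ ↦ Real.sqrt ‖V τ‖) atImInfty (𝓝 0) := by
    simpa using hV.norm.sqrt
  have h3 : (fun τ : ℍ ↦ ‖u τ‖) = fun τ ↦ Real.sqrt ‖V τ‖ := funext h1
  rw [IsZeroAtImInfty, ZeroAtFilter, tendsto_zero_iff_norm_tendsto_zero, h3]
  exact h2

/-! ### §2 Slash bookkeeping -/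

/-- `tr T = 2`. [folklore] -/
theorem trace_T : ((ModularGroup.T : SL(2, ℤ)) : Matrix (Fin 2) (Fin 2) ℤ).trace = 2 := by
  simp [ModularGroup.T, Matrix.trace_fin_two]

/-- A cusp form on `Γ₁(N)` is zero at `i∞`. [folklore] -/
theorem isZeroAtImInfty_cuspForm_gamma1 {N : ℕ} [NeZero N] {k : ℤ} (F : CuspForm (Gamma1 N) k) :
    IsZeroAtImInfty (F : ℍ → ℂ) := by
  simpa using CuspFormClass.zero_at_infty_slash F (1 : SL(2, ℤ))

/-- A modular form on `Γ₀(N)` is bounded at `i∞`. [folklore] -/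
theorem isBoundedAtImInfty_modularForm_gamma0 {N : ℕ} [NeZero N] {k : ℤ} (F : ModularForm (Gamma0 N) k) :
    IsBoundedAtImInfty (F : ℍ → ℂ) := by
  simpa using ModularFormClass.bdd_at_infty_slash F (1 : SL(2, ℤ))

/-- Norm of the slash of a product with a square: `‖((u·h)|_{k₁+k₂}A) τ‖² = ‖(V|_{k₁+k₁}A) τ‖ · ‖((h·h)|_{k₂+k₂}A) τ‖`
when `u² = V`. [folklore] -/
theorem norm_sq_mul_slash {u V h : ℍ → ℂ} (husq : ∀ τ, u τ ^ 2 = V τ) (k₁ k₂ : ℤ) (A : SL(2, ℤ)) (τ : ℍ) :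
    ‖((u * h) ∣[k₁ + k₂] A) τ‖ ^ 2 = ‖(V ∣[k₁ + k₁] A) τ‖ * ‖((h * h) ∣[k₂ + k₂] A) τ‖ := by
  have hV : V ∣[k₁ + k₁] A = (u * u) ∣[k₁ + k₁] A := by
    congr 1
    funext z
    rw [Pi.mul_apply, ← sq, husq]
  rw [mul_slash_SL2, mul_slash_SL2, hV, mul_slash_SL2]
  simp only [Pi.mul_apply, norm_mul]
  ring

/-! ### §3 The twisted Kummer form -/

/-- **The twisted Kummer form.**  With the Eisenstein parity data `(β, g')` (`g' ≠ 0`, periods of `Γ₁(N)` in `ℤg'`, even on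
parabolics), the untwisted Kummer parity group `Γ′` and the twisted group `Γ″` (membership predicates), the square root `u` of
the Eisenstein `η`-quotient (`u² = V ∈ M_{24m}(Γ₀(N))`, multiplier `(−1)^{φ_β/g'}`) and a cusp form `hκ ∈ S_k(Γ′)`, `±`-equivariant
under `Γ₁(N)` with `hκ² = Ψ·G` for cusp forms `Ψ, G ∈ S_k(Γ₁(N))`: the product `u·hκ` is a non-zero cusp form of weight `12m + k`
on `Γ″`, anti-invariant under `Γ₁(N) ∖ Γ″`, and its `q`-expansion is the product of the `q`-expansions.
[cite: ShimuraIATAF1971, §2.1 and Thm. 2.10] -/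
theorem twistedCuspForm {N : ℕ} [NeZero N] (f : CuspForm (Gamma0 N) 2) (L₀ : PeriodPair) (q : ℚ) (lam : ℂ)
    (β : ℕ → ℕ) (g' : ℚ) (hg0 : g' ≠ 0)
    (hper : ∀ γ : SL(2, ℤ), γ ∈ Gamma1 N → ∃ n : ℤ,
      stabEisensteinPeriod N β (γ 0 0) (γ 0 1) (γ 1 0) (γ 1 1) = n * g')
    (hcusp : ∀ γ : SL(2, ℤ), γ ∈ Gamma1 N → (γ : Matrix (Fin 2) (Fin 2) ℤ).trace = 2 →
      ∃ n : ℤ, stabEisensteinPeriod N β (γ 0 0) (γ 0 1) (γ 1 0) (γ 1 1) = n * g' ∧ Even n)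
    {Γ' Γ'' : Subgroup SL(2, ℤ)}
    (hΓ' : ∀ γ : SL(2, ℤ), γ ∈ Γ' ↔ ∃ hγ : γ ∈ Gamma0 N, γ ∈ Gamma1 N ∧
      ∃ k : ℤ, ∃ w ∈ L₀.lattice, (q : ℂ) * cuspSymbol f ⟨γ, hγ⟩ = (k : ℂ) * lam + 2 * w)
    (hΓ'' : ∀ γ : SL(2, ℤ), γ ∈ Γ'' ↔ ∃ hγ : γ ∈ Gamma0 N, γ ∈ Gamma1 N ∧
      ((∃ n : ℤ, stabEisensteinPeriod N β (γ 0 0) (γ 0 1) (γ 1 0) (γ 1 1) = n * g' ∧ Even n) ↔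
        ∃ k : ℤ, ∃ w ∈ L₀.lattice, (q : ℂ) * cuspSymbol f ⟨γ, hγ⟩ = (k : ℂ) * lam + 2 * w))
    {m : ℕ} (V : ModularForm (Gamma0 N) ((12 * m : ℕ) + (12 * m : ℕ) : ℤ)) (u : ℍ → ℂ)
    (hud : MDifferentiable 𝓘(ℂ) 𝓘(ℂ) u) (hune : ∀ τ : ℍ, u τ ≠ 0) (husq : ∀ τ : ℍ, u τ ^ 2 = V τ)
    (humul : ∀ γ : SL(2, ℤ), γ ∈ Gamma0 N → ∀ n : ℤ,
      stabEisensteinPeriod N β (γ 0 0) (γ 0 1) (γ 1 0) (γ 1 1) = n * g' →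
        u ∣[((12 * m : ℕ) : ℤ)] γ = ((-1 : ℂ) ^ n.natAbs) • u)
    {k : ℤ} (hκ : CuspForm Γ' k) (hκ0 : (hκ : ℍ → ℂ) ≠ 0)
    (hanti : ∀ γ ∈ Gamma1 N, γ ∉ Γ' → (hκ : ℍ → ℂ) ∣[k] γ = -hκ)
    (Ψ G : CuspForm (Gamma1 N) k) (hsq : ∀ τ : ℍ, hκ τ ^ 2 = Ψ τ * G τ) :
    ∃ h : CuspForm Γ'' (((12 * m : ℕ) : ℤ) + k),
      (∀ τ : ℍ, h τ = u τ * hκ τ) ∧ (h : ℍ → ℂ) ≠ 0 ∧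
      (∀ γ ∈ Gamma1 N, γ ∉ Γ'' → (h : ℍ → ℂ) ∣[((12 * m : ℕ) : ℤ) + k] γ = -h) ∧
      qExpansion 1 h = qExpansion 1 u * qExpansion 1 (hκ : ℍ → ℂ) := by
  -- invariance of `hκ` under `Γ′`
  have hinvκ : ∀ γ : SL(2, ℤ), γ ∈ Γ' → (hκ : ℍ → ℂ) ∣[k] γ = hκ := fun γ hγ ↦
    SlashInvariantForm.slash_action_eqn hκ _ ⟨γ, hγ, rfl⟩
  -- uniqueness of the Eisenstein integer
  have huniq : ∀ {γ : SL(2, ℤ)} {n : ℤ}, stabEisensteinPeriod N β (γ 0 0) (γ 0 1) (γ 1 0) (γ 1 1) = n * g' →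
      ((∃ n' : ℤ, stabEisensteinPeriod N β (γ 0 0) (γ 0 1) (γ 1 0) (γ 1 1) = n' * g' ∧ Even n') ↔ Even n) := by
    intro γ n hn
    refine ⟨fun ⟨n', hn', he⟩ ↦ ?_, fun he ↦ ⟨n, hn, he⟩⟩
    have : (n' : ℚ) = n := mul_right_cancel₀ hg0 (hn'.symm.trans hn)
    have h' : n' = n := by exact_mod_cast this
    exact h' ▸ he
  -- the sign of `u` in terms of the parity of `n`
  have hsign_even : ∀ {n : ℤ}, Even n → ((-1 : ℂ) ^ n.natAbs) = 1 := fun {n} he ↦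
    Even.neg_one_pow (Int.natAbs_even.mpr he)
  have hsign_odd : ∀ {n : ℤ}, ¬ Even n → ((-1 : ℂ) ^ n.natAbs) = -1 := fun {n} ho ↦
    Odd.neg_one_pow (Int.natAbs_odd.mpr (Int.not_even_iff_odd.mp ho))
  -- the product and its slashes on `Γ₁(N)`
  set H : ℍ → ℂ := u * (hκ : ℍ → ℂ) with hHdef
  have hslash : ∀ γ : SL(2, ℤ), γ ∈ Gamma1 N → ∀ n : ℤ,
      stabEisensteinPeriod N β (γ 0 0) (γ 0 1) (γ 1 0) (γ 1 1) = n * g' →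
      H ∣[((12 * m : ℕ) : ℤ) + k] γ =
        (((-1 : ℂ) ^ n.natAbs) • u) * ((hκ : ℍ → ℂ) ∣[k] γ) := by
    intro γ hγ n hn
    rw [hHdef, mul_slash_SL2, humul γ (Gamma1_in_Gamma0 N hγ) n hn]
  have hplus : ∀ γ : SL(2, ℤ), γ ∈ Γ'' → H ∣[((12 * m : ℕ) : ℤ) + k] γ = H := by
    intro γ hγ''
    obtain ⟨hγ0, hγ1, hiff⟩ := (hΓ'' γ).mp hγ''
    obtain ⟨n, hn⟩ := hper γ hγ1
    rw [hslash γ hγ1 n hn]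
    by_cases he : Even n
    · have hκmem : γ ∈ Γ' := (hΓ' γ).mpr ⟨hγ0, hγ1, hiff.mp ⟨n, hn, he⟩⟩
      rw [hinvκ γ hκmem, hsign_even he, one_smul]
    · have hκnot : γ ∉ Γ' := fun hmem ↦ by
        obtain ⟨hγ0', -, hk⟩ := (hΓ' γ).mp hmem
        exact he (((huniq hn).mp (hiff.mpr hk)))
      rw [hanti γ hγ1 hκnot, hsign_odd he]
      ext τ
      simp [hHdef]
  have hminus : ∀ γ ∈ Gamma1 N, γ ∉ Γ'' → H ∣[((12 * m : ℕ) : ℤ) + k] γ = -H := by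
    intro γ hγ1 hγ''
    have hγ0 : γ ∈ Gamma0 N := Gamma1_in_Gamma0 N hγ1
    obtain ⟨n, hn⟩ := hper γ hγ1
    have hiff : ¬ ((∃ n' : ℤ, stabEisensteinPeriod N β (γ 0 0) (γ 0 1) (γ 1 0) (γ 1 1) = n' * g' ∧ Even n') ↔
        ∃ k : ℤ, ∃ w ∈ L₀.lattice, (q : ℂ) * cuspSymbol f ⟨γ, hγ0⟩ = (k : ℂ) * lam + 2 * w) :=
      fun h ↦ hγ'' ((hΓ'' γ).mpr ⟨hγ0, hγ1, h⟩)
    rw [huniq hn] at hiff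
    rw [hslash γ hγ1 n hn]
    by_cases he : Even n
    · have hκnot : γ ∉ Γ' := fun hmem ↦ by
        obtain ⟨hγ0', -, hk⟩ := (hΓ' γ).mp hmem
        exact hiff ⟨fun _ ↦ hk, fun _ ↦ he⟩
      rw [hanti γ hγ1 hκnot, hsign_even he, one_smul]
      ext τ
      simp [hHdef]
    · have hκmem : γ ∈ Γ' := by
        by_contra hmem
        exact hiff ⟨fun h ↦ absurd h he, fun hk ↦ absurd ((hΓ' γ).mpr ⟨hγ0, hγ1, hk⟩) hmem⟩
      rw [hinvκ γ hκmem, hsign_odd he]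
      ext τ
      simp [hHdef]
  -- cusp decay everywhere: `‖H|A‖² = ‖(V·Ψ)|A‖ · ‖G|A‖`
  have hzero : ∀ A : SL(2, ℤ), IsZeroAtImInfty (H ∣[((12 * m : ℕ) : ℤ) + k] A) := by
    intro A
    have hΨG : ((hκ : ℍ → ℂ) * (hκ : ℍ → ℂ)) ∣[k + k] A = ((Ψ : ℍ → ℂ) ∣[k] A) * ((G : ℍ → ℂ) ∣[k] A) := by
      rw [← mul_slash_SL2]
      congr 1
      funext τ
      rw [Pi.mul_apply, Pi.mul_apply, ← sq, hsq]
    have ha : IsZeroAtImInfty (((V : ℍ → ℂ) ∣[((12 * m : ℕ) : ℤ) + ((12 * m : ℕ) : ℤ)] A) * ((Ψ : ℍ → ℂ) ∣[k] A)) :=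
      isZeroAtImInfty_mul_of_bdd (ModularFormClass.bdd_at_infty_slash V A) (CuspFormClass.zero_at_infty_slash Ψ A)
    have hb : IsZeroAtImInfty ((G : ℍ → ℂ) ∣[k] A) := CuspFormClass.zero_at_infty_slash G A
    refine KummerForm.isZeroAtImInfty_of_norm_sq_eq (fun τ ↦ ?_) ha hb
    rw [hHdef, norm_sq_mul_slash husq, hΨG, Pi.mul_apply, Pi.mul_apply, norm_mul, norm_mul]
    ring
  -- the cusp form on `Γ″`
  let h : CuspForm Γ'' (((12 * m : ℕ) : ℤ) + k) :=
    { toFun := H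
      slash_action_eq' := fun A hA ↦ by
        obtain ⟨γ, hγ, rfl⟩ := hA
        exact hplus γ hγ
      holo' := hud.mul hκ.holo'
      zero_at_cusps' := fun {c} hc ↦ by
        have hc' : IsCusp c 𝒮ℒ := hc.mono (Subgroup.map_le_range _ _)
        rw [OnePoint.isZeroAt_iff_forall_SL2Z hc']
        intro A _
        exact hzero A }
  have hcoe : (⇑h : ℍ → ℂ) = H := rfl
  refine ⟨h, fun τ ↦ by rw [hcoe, hHdef, Pi.mul_apply], ?_, fun γ hγ hγ' ↦ by rw [hcoe]; exact hminus γ hγ hγ', ?_⟩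
  · -- `h ≠ 0`
    intro h0
    rw [hcoe] at h0
    apply hκ0
    funext τ
    have := congr_fun h0 τ
    rw [hHdef, Pi.mul_apply, Pi.zero_apply, mul_eq_zero] at this
    exact this.resolve_left (hune τ)
  · -- `q`-expansions multiply
    rw [hcoe, hHdef]
    -- `T ∈ Γ′`, `T ∈ Γ″`, so both factors are `1`-periodic
    have hTκ : ModularGroup.T ∈ Γ' :=
      ParityGroup.mem_of_trace_eq_two f L₀ q lam hΓ' (UBD.T_mem_Gamma1 N) trace_T
    obtain ⟨nT, hnT, hnTe⟩ := hcusp _ (UBD.T_mem_Gamma1 N) trace_T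
    have huT : u ∣[((12 * m : ℕ) : ℤ)] ModularGroup.T = u := by
      rw [humul _ (modularT_mem_Gamma0 N) nT hnT, hsign_even hnTe, one_smul]
    have hκT : (hκ : ℍ → ℂ) ∣[k] ModularGroup.T = hκ := hinvκ _ hTκ
    have hu_per : Periodic (u ∘ ofComplex) 1 := periodic_of_slash_T huT
    have hκ_per : Periodic ((hκ : ℍ → ℂ) ∘ ofComplex) 1 := periodic_of_slash_T hκT
    have hu_bdd : IsBoundedAtImInfty u :=
      isBoundedAtImInfty_of_norm_sq (fun τ ↦ by rw [← norm_pow, husq]) (isBoundedAtImInfty_modularForm_gamma0 V)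
    have hκ_bdd : IsBoundedAtImInfty (hκ : ℍ → ℂ) := by
      refine (isZeroAtImInfty_of_norm_sq' (V := fun τ ↦ Ψ τ * G τ) (fun τ ↦ by rw [← norm_pow, hsq]) ?_).boundedAtFilter
      exact isZeroAtImInfty_mul_of_bdd (isZeroAtImInfty_cuspForm_gamma1 Ψ).boundedAtFilter
        (isZeroAtImInfty_cuspForm_gamma1 G)
    exact UpperHalfPlane.qExpansion_mul
      (UpperHalfPlane.analyticAt_cuspFunction_zero one_pos hu_per hud hu_bdd)
      (UpperHalfPlane.analyticAt_cuspFunction_zero one_pos hκ_per hκ.holo' hκ_bdd)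

end Summit.BirchSwinnertonDyer.BirchSwinnertonDyer.Theorems.DepletionAtTwo.KummerSigma

end
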